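import Mathlib.CategoryTheory.SingleObj
import Mathlib.CategoryTheory.Equivalence
import Mathlib.CategoryTheory.Whiskering
import Literature.AnabelianGeometry.AbsoluteAnabelian.LogShellsOfUnitLog
import Literature.IUT.LogVolume.LogRadius
import HarnessLib

/-!
# [AbsTopIII] §5, Remarks 5.2.1–5.9.2 (pp. 121–145): the remarks of §5 before Corollary 5.10

S. Mochizuki, *Topics in Absolute Anabelian Geometry III: Global Reconstruction Algorithms*, §5
"Global Log-Frobenius Compatibility"; locators `p.N` are PDF pages of the author's kurims
manuscript (lit key `paper:url-5493eb38cbb7`, 164 pp.; the journal pagination is not held)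
[cite: MochizukiAbsTopIII2015, Rmk 5.4.2 p.129].  Cell abc-iut, layer L4, block W2-B15
(plan/L4/ASSIGNMENTS.md §7a, abc-iut-L4-lead RULING π 2026-08-25); node ids
`AbsTopIII:Rmk5.2.1` … `AbsTopIII:Rmk5.9.2` of plan/L4/NODES.md (Remarks 5.10.x are block W2-B8,
`AbsTopIII/RemarksLogShells.lean`, abc-iut-L4-t16; Rmk 5.1.1 and 5.7.1 are abc-iut-L4-t3's).
HONEST FRAMING: this file takes no side on [IUTchIII] Cor. 3.12; it indexes fifteen REMARKS of a
refereed paper, most of which are interpretive prose about the categories of Cor. 5.2 / Def. 5.3 /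
Def. 5.6 / Def. 5.9 (typed by abc-iut-L4-t3: `GaloisTheaters`, `PanalocalTheaters`, `TPairs`,
`ArithmeticLineBundles`, `MonoAnalyticLogShells`, `LogFrobeniusCompatibility`), and PROVES the few
elementary mathematical kernels; nothing here is a reconstruction theorem.

## Index (Remark → page → status; "record" = interpretive prose, recorded by locator only)

* **5.2.1** p. 121 — "neither of the composite functors `EA⊚ → Th✠`, `EA⊚ → Th✠_T` of Cor. 5.2
  (v), (vi) is an equivalence of categories … there is no natural, functorial way to 'glue together'
  the various local data of a panalocal Galois-theater".  TYPED BY abc-iut-L4-t3 as the named fact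
  `PanalocalizationNotEquivalence` (staged `PanalocalTheaters.lean`, filing behind p405186
  `GaloisTheaters`); cited here, not restated (TODO-import when built).
* **5.2.2** p. 121 — "by applying the equivalence `EA⊚ ≃ Th⊚` of Cor. 5.2 (i), one may obtain a
  factorization `EA⊚ → Th⊚ → An⊚[Th⊚_T]` of the functor of Cor. 5.2 (iv). Thus we obtain equivalences
  of categories `Th⊚ ≃ An⊚[Th⊚_T] ≃ Th⊚`".  The formal content (two equivalences out of `EA⊚`
  induce an equivalence between their targets, through which the second functor factors up to
  isomorphism) is TYPED AND PROVED in exactly that abstract shape: `Rmk_5_2_2_shape`.  The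
  concrete categories are abc-iut-L4-t3's (TODO-import).
* **5.2.3** pp. 121–122 — "a similar result to Cor. 5.2 (ii) [hence (iii), (iv)] may be obtained
  when `T = T_LG`, by using the archimedean primes, which are immune to the `{±1}`-indeterminacy of
  Prop. 3.3 (i)": a functorial algorithm `μ_Ẑ(M⊚) ≅ μ_Ẑ(Π)` via `k_NF(Π) ↪ A_X(Π, v^ell) ≅ A_{X_v}`
  (Def. 5.1 (iii)(v)) and Cor. 1.10 (c), Rmk. 1.10.3 (ii) at nonarchimedean `v`.  Record (an
  algorithm sketch over Cor. 1.10 / Prop. 3.3 outputs; inherits the FACT status of Cor. 5.2 (ii)).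
* **5.3.1** p. 124 — defines the category `An⊚[Th⊚_T, |⊡|]` of data
  `M⊚|⊡|_T(Π) := (M⊚_T(Π), Th⊚|⊡|_T[M⊚_T[Π]])` for `Π ∈ Ob(EA⊚)` with morphisms induced by `EA⊚`, and
  asserts that all functors `EA⊚ → An⊚[Th⊚_T,|⊡|] → An⊚[Th⊚_T] → Th⊚_T → EA⊚` are equivalences
  "just as in Cor. 5.2 (iv)".  Abstract kernel = abc-iut-L4-t16's `WithAlgorithms C A` /
  `forgetAlgorithms_isEquivalence` (`AbsTopIII/RemarksLogShells.lean`, p404925: decorating the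
  objects of a category by canonically determined nonempty data yields an equivalent category),
  applied twice; the concrete decoration `Th⊚|⊡|_T[·]` is Def. 5.3 (ii)(iii) (abc-iut-L4-t3's
  `ArithmeticLineBundles`, p405142).  Record + pointers; no second copy of `WithAlgorithms` (η).
* **5.4.1** p. 129 — "the diagrams of Def. 5.4 (iii), (v) [hence also the natural transformations of
  Def. 5.4 (vii)] cannot be extended to global number fields … the various logarithms at the various
  completions of a number field do not induce maps from, say, the group of units of the number field
  to the number field".  Record (heuristic; the precise transcendence statement behind it — Mahler's
  `p`-adic Hermite–Lindemann — is neither stated in print nor in Mathlib).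
* **5.4.2** p. 129 — "when `k` is not absolutely unramified, the 'gap' between `𝒪^{Π_k}_{k∼}` and `ℐ`
  may be bounded in terms of the ramification index of `k` over `ℚ_{p_k}`. We leave the routine
  details to the interested reader."  TYPED AND PROVED for the REAL `p`-adic logarithm
  (abc-iut-S1's `unitLog`, abc-iut-L3-t11's standard model `PadicLogOnUnits.ofUnitLog` of
  abc-iut-L4-t3's log-shell `logShell`): `Rmk_5_4_2_gap` —
  `𝒪_k ⊆ ℐ_k ⊆ p^{-(b(p,e) + c_p)} · 𝒪_k` with `b(p, e) = ⌊log(p·e/(p−1))/log p⌋ − 1/e` the exponent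
  of [IUTchIV] Prop. 1.2 (i) (S1's `logRadiusB`, `logUnits_subset_pBall_neg_logRadiusB`) and
  `c_p = v_p(p*) ∈ {1, 2}`; the bound depends only on `p` and the ramification index `e`.
* **5.4.3** p. 129 — the inclusions "`𝒪^{Π_k}_{k∼} ⊆ ℐ`", "`𝒪_{k∼} ⊆ ℐ`" of Def. 5.4 (iii), (v) "may be
  thought of as inclusions, within the log-shell, of the various localizations of the trivial
  ⊞-line bundle of Def. 5.3 (ii)", whose definition "involves … not just the additive but also the
  multiplicative structure of the global ring of integers".  Record (interpretation; the trivial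
  ⊞-line bundle is abc-iut-L4-t3's `AddLineBundle.trivial`, p405142).
* **5.5.1** p. 133 — "the general formal content of the remarks following Corollaries 3.6, 3.7
  applies to the situation discussed in Corollary 5.5, as well … routine details … to the
  interested reader".  Record (those remarks are blocks W2-B1/B2/B3: abc-iut-L4-t5, -t9, -t12).
* **5.5.2** p. 133 — "it does not appear realistic to attempt to construct a theory of geometric
  panalocalization with respect to the various closed points of the hyperbolic orbicurve over an
  MLF … the decomposition groups of such closed points do not satisfy an appropriate analogue of
  Cor. 1.10" (cf. Rmks. 1.11.5, 3.7.7 (ii), 1.9.4).  Record (negative heuristic, no claim).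
* **5.6.1 (i)** p. 137 — "a monoid `M` may be thought of as a [1-]category `C_M` consisting of a
  single object whose monoid of endomorphisms is given by `M`. In a similar vein, a ring `R` … may be
  thought of as a 2-category consisting of the single 1-category `C_{R⊞}`, together with the functors
  `C_{R⊞} → C_{R⊞}` arising from left multiplication by elements of `R`."  TYPED AND PROVED over
  Mathlib's one-object category `CategoryTheory.SingleObj`: `Rmk_5_6_1_i_monoid`
  (`End(∗) ≃* M`) and `Rmk_5_6_1_i_ring` (left multiplications are functors `C_{R⊞} ⥤ C_{R⊞}`,
  multiplicatively in `r`, the functor `Φ r` corresponding under `SingleObj.mapHom` to the additive map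
  `x ↦ r x`).
* **5.6.1 (ii)** p. 137 — "a monoid may be thought of as a mathematical object with one
  combinatorial dimension, a ring … with two combinatorial dimensions" ~ the two cohomological
  dimensions of `G_k` for an MLF, the two real dimensions of a CAF; "ring structures correspond to
  holomorphic structures"; mono-analyticization = "passing from rings to monoids".  Record.
* **5.8.1 (i)** pp. 142–143 — summary of the archimedean portion of Prop. 5.8: mono-analyticizing
  an isomorph of `𝒪▷_ℂ` yields an object of `TM⊢` subject to dilations (Rmk. 2.7.3); the category
  `TB⊞` preserves the "metric rigidity" of log-shells ("the metric rigidity of `S¹ ≅ 𝒪^×_ℂ` together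
  with the rotation automorphisms of `Lie(ℂ^×)` of order 4", Def. 5.6 (iv)) at the cost of relating
  the two factors of `ℂ∼ × ℂ∼` only up to a `{±1}`-indeterminacy.  Record (the objects are
  abc-iut-L4-t3's `MonoAnalyticArch`, p404450).
* **5.8.1 (ii)** p. 143 — the archimedean discussion of (i) "is strongly reminiscent of the
  nonarchimedean portion of Prop. 5.8, which allows one to construct metrically rigid log-shells
  which are immune to mono-analyticization, but only at the expense of sacrificing the ring/field
  structures involved".  Record.
* **5.9.1** pp. 144–145 — defines, "just as in Rmk. 5.3.1", the categories `An⊚[Th•_T, μ]`,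
  `An✠[Th✠_T, μ]`, `An⊚[Th⊚_T, |⊡|, μ]` of data decorated with the log-volumes of Def. 5.9 (ii)(iii),
  and asserts that in the three displayed sequences of natural functors (first line
  `EA⊚ → An⊚[Th•_T, μ] → An⊚[Th•_T] → Th•_T → Th•`) every arrow — "with the exception of the second
  to last arrow of the first line of the above display in the case where `• = ✠`" (p. 145), i.e.
  except the forgetful arrow `An⊚[Th✠_T] → Th✠_T` (cf. Cor. 5.2 (vi) and Rmk. 5.2.1: the composite
  `EA⊚ → Th✠_T` is not an equivalence) — is an equivalence (Cor. 5.2 (i)(iv)(v)(vii), Rmk. 5.3.1).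
  Record + pointers as for 5.3.1 (abstract kernel `forgetAlgorithms_isEquivalence`; log-volumes =
  abc-iut-L4-t3's `MonoAnalyticNonarch.logVol` / `globalLogVolume`).  [Referee finding F17 (a),
  aud-11: an earlier version of this record misnamed the exceptional arrow as `Th•_T → Th•`.]
* **5.9.2** p. 145 — "The significance of measuring [log-]volumes in units that belong to the
  copies of `ℝ` determined by “`ℝ_non(−)`”, “`ℝ_arc(−)`” lies in the fact that such measurements may
  compared [sic — read "may be compared"] on both sides of the “log-wall”, as well as in a fashion
  compatible with the operation of mono-analyticization [cf. the discussion of Remark 3.7.7;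
  Corollary 5.10, (ii), (iv), below]" (verbatim, p. 145).  Record (the comparison statements
  themselves are Cor. 5.10 (ii)(iv), abc-iut-L4-t3).  [Referee finding F17 (b), aud-11: the print
  typo "may compared" is now quoted verbatim and marked, no longer silently normalised.]

No new definitions (theorems only); abc-iut-L4-t3's and abc-iut-S1's files are imported, never
restated.
-/

noncomputable section

namespace Literature.AnabelianGeometry.AbsoluteAnabelian.AbsTopIII

universe v₁ v₂ v₃ u₁ u₂ u₃ u

/-! ### Remark 5.2.2: the formal shape "two equivalences out of `EA⊚` factor one another" -/

section Rmk522

open CategoryTheory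

/-- **Rmk. 5.2.2, abstract shape** (p. 121): if `e₁ : E ≌ T` (Cor. 5.2 (i), `EA⊚ ≃ Th⊚`) and
`e₂ : E ≌ A` (Cor. 5.2 (iv), `EA⊚ ≃ An⊚[Th⊚_T]`) are equivalences of categories, then there is an
equivalence `F : T ⥤ A` (namely `e₁⁻¹ ⋙ e₂`) through which `e₂` factors up to natural isomorphism,
`E → T → A`: "we obtain equivalences of categories `Th⊚ ≃ An⊚[Th⊚_T] ≃ Th⊚`".
[cite: MochizukiAbsTopIII2015, Rmk 5.2.2 p.121] -/
theorem Rmk_5_2_2_shape {E : Type u₁} [Category.{v₁} E] {T : Type u₂} [Category.{v₂} T]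
    {A : Type u₃} [Category.{v₃} A] (e₁ : E ≌ T) (e₂ : E ≌ A) :
    ∃ F : T ⥤ A, F.IsEquivalence ∧ Nonempty (e₁.functor ⋙ F ≅ e₂.functor) := by
  refine ⟨(e₁.symm.trans e₂).functor, (e₁.symm.trans e₂).isEquivalence_functor, ⟨?_⟩⟩
  change e₁.functor ⋙ (e₁.inverse ⋙ e₂.functor) ≅ e₂.functor
  exact (Functor.associator _ _ _).symm ≪≫ Functor.isoWhiskerRight e₁.unitIso.symm e₂.functor ≪≫
    e₂.functor.leftUnitor

end Rmk522

/-! ### Remark 5.4.2: the gap between `𝒪_k` and the log-shell `ℐ_k`, bounded in terms of `e` -/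

section Rmk542

open Set Metric
open scoped Pointwise
open Literature.IUT.LogVolume Literature.NumberTheory.Transcendental

variable (p : ℕ) [Fact p.Prime]
variable (K : Type u) [NontriviallyNormedField K] [NormedAlgebra ℚ_[p] K] [IsUltrametricDist K]
  [ProperSpace K]

/-- **Rmk. 5.4.2** (p. 129: "when `k` is not absolutely unramified, the 'gap' between
`𝒪^{Π_k}_{k∼}` and `ℐ` may be bounded in terms of the ramification index of `k` over `ℚ_{p_k}`"),
TYPED AND PROVED for the genuine `p`-adic logarithm: for a finite extension `K/ℚ_p` with absolute
ramification index `e`, the log-shell `ℐ_K = (p*)⁻¹ · log_p(𝒪_K^×)` of [AbsTopIII] Def. 5.4 (iii)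
(abc-iut-L4-t3's `logShell` on abc-iut-L3-t11's standard model `PadicLogOnUnits.ofUnitLog`)
satisfies `𝒪_K ⊆ ℐ_K ⊆ p^{-(b + c_p)} · 𝒪_K`, where `b = ⌊log(p e/(p−1))/log p⌋ − 1/e` is the
exponent of [IUTchIV] Prop. 1.2 (i) (abc-iut-S1's `logRadiusB`, whose `log_p(𝒪_K^×) ⊆ p^{−b}·𝒪_K`
is `logUnits_subset_pBall_neg_logRadiusB`) and `c_p = v_p(p*)` (`1` for odd `p`, `2` for `p = 2`):
a bound depending only on `p` and `e`. [cite: MochizukiAbsTopIII2015, Rmk 5.4.2 p.129] -/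
theorem Rmk_5_4_2_gap :
    closedBall (0 : K) 1 ⊆ logShell (PadicLogOnUnits.ofUnitLog p K) ∧
      logShell (PadicLogOnUnits.ofUnitLog p K) ⊆
        pBall p K (-(logRadiusB p (absRamificationIdx p K) + ((if p = 2 then 2 else 1 : ℕ) : ℝ))) := by
  refine ⟨closedBall_subset_logShell_ofUnitLog p K, ?_⟩
  have hp : p.Prime := Fact.out
  have hp0 : (0 : ℝ) < p := by exact_mod_cast hp.pos
  rw [logShell_ofUnitLog]
  rintro _ ⟨y, hy, rfl⟩
  have hy' := logUnits_subset_pBall_neg_logRadiusB p K hy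
  rw [mem_pBall_iff] at hy' ⊢
  rw [neg_neg] at hy' ⊢
  dsimp only
  rw [smul_eq_mul, norm_mul, norm_inv, norm_pstarNat_cast, Real.rpow_add hp0, Real.rpow_natCast,
    inv_pow, inv_inv, mul_comm]
  exact mul_le_mul_of_nonneg_right hy' (pow_nonneg hp0.le _)

end Rmk542

/-! ### Remark 5.6.1 (i): monoids as one-object categories, rings as "2-categories" -/

section Rmk561

open CategoryTheory

/-- **Rmk. 5.6.1 (i), first sentence** (p. 137): "a monoid `M` may be thought of as a [1-]category
`C_M` consisting of a single object whose monoid of endomorphisms is given by `M`" — Mathlib's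
one-object category `SingleObj M`, whose endomorphism monoid of the unique object `∗` is `M`.
[cite: MochizukiAbsTopIII2015, Rmk 5.6.1 (i) p.137] -/
theorem Rmk_5_6_1_i_monoid (M : Type u) [Monoid M] :
    Nonempty (M ≃* End (SingleObj.star M)) :=
  ⟨SingleObj.toEnd M⟩

/-- **Rmk. 5.6.1 (i), second sentence** (p. 137): "a ring `R`, whose underlying additive group we
denote by `R⊞`, may be thought of as a 2-category consisting of the single 1-category `C_{R⊞}`,
together with the functors `C_{R⊞} → C_{R⊞}` arising from left multiplication by elements of `R`"
— over Mathlib's `SingleObj (Multiplicative R)` (= `C_{R⊞}`): there is an assignment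
`r ↦ Φ r : C_{R⊞} ⥤ C_{R⊞}`, `Φ r` being the functor corresponding (Mathlib `SingleObj.mapHom`) to the
additive endomorphism `x ↦ r·x` of `R⊞`, with `Φ 1 = 𝟭` and `Φ (r s) = Φ s ⋙ Φ r` (the
multiplicative structure of `R` becomes composition of functors). [cite: MochizukiAbsTopIII2015, Rmk 5.6.1 (i) p.137] -/
theorem Rmk_5_6_1_i_ring (R : Type u) [Ring R] :
    ∃ Φ : R → (SingleObj (Multiplicative R) ⥤ SingleObj (Multiplicative R)),
      (∀ r : R, (SingleObj.mapHom (Multiplicative R) (Multiplicative R)).symm (Φ r) =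
        (AddMonoidHom.mulLeft r).toMultiplicative) ∧
      Φ 1 = 𝟭 _ ∧ ∀ r s : R, Φ (r * s) = Φ s ⋙ Φ r := by
  let φ : R → (Multiplicative R →* Multiplicative R) := fun r ↦
    (AddMonoidHom.mulLeft r).toMultiplicative
  refine ⟨fun r ↦ SingleObj.mapHom _ _ (φ r), fun r ↦ Equiv.symm_apply_apply _ _, ?_, fun r s ↦ ?_⟩
  · have h1 : φ 1 = MonoidHom.id _ := by
      ext x
      simp [φ]
    change SingleObj.mapHom _ _ (φ 1) = _
    rw [h1]
    exact SingleObj.mapHom_id _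
  · have hrs : φ (r * s) = (φ r).comp (φ s) := by
      ext x
      simp [φ, mul_assoc]
    change SingleObj.mapHom _ _ (φ (r * s)) = _
    rw [hrs]
    exact SingleObj.mapHom_comp (φ s) (φ r)

end Rmk561

end Literature.AnabelianGeometry.AbsoluteAnabelian.AbsTopIII
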